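import Literature.Probability.LatticeModels.SlitPlaneSpinor
import HarnessLib

/-!
# The slit-plane kernel, VII: the single-valued section `U` of the full-plane spinor and its
# discrete Cauchy–Riemann table

Topic `Literature/Probability/LatticeModels`; sequel of `SlitPlaneSpinor.lean`. The explicit
two-sheet full-plane spinor of Chelkak–Hongler–Izyurov (Ann. of Math. 181 (2015), Lemma 2.14,
§3.2) is realised there by the two sheets `slitFup`, `slitFdn` (equal off the row `s = 0`, opposite
on the odd points of the negative row); here we fix the **section** of the double cover whose branch
cut is CHI's `L_a` seen from below,

  `slitU k s = slitFup k s` for `s ≥ 0`,  `= slitFdn k s` for `s ≤ -1`,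

and tabulate its discrete Cauchy–Riemann identity
`i (U(k+1,s+1) - U(k,s)) = U(k,s+1) - U(k+1,s)` on the unit cells `{k,k+1} × {s,s+1}`
(= s-holomorphicity at the `λ`-type corner at the cell's centre, CHI Remark 3.1 (3.2)):
it holds on every cell except the cut cells `s = -1`, `k ≤ -1` (`slitU_cr`); on the cut cells with
`k ≤ -2` it holds after flipping the sign of the lower row (`slitU_cr_cut`: the sheet change across
`L_a`), and the cell `k = -1`, `s = -1` carries the source singularity (values `U(0,0) = 1`,
`U(-1,0) = -i`, `slitU_zero_zero`, `slitU_neg_one_zero`). This is the form in which the explicit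
spinor is transplanted into the tree's corner frame (`IsSHolAt` of `SHolomorphicPrimitive.lean`).
Everything is proved; no named fact.

## References

* D. Chelkak, C. Hongler, K. Izyurov, Ann. of Math. 181 (2015) = arXiv:1202.2838: Lemma 2.14,
  Remark 3.1, §3.2 [ChelkakHonglerIzyurovAnnals2015].
-/

noncomputable section

open Complex

namespace Literature.Probability.LatticeModels

/-- **The section of the full-plane spinor with branch cut `L_a` (from below)**: `slitFup` on the
closed upper half `s ≥ 0`, `slitFdn` on `s ≤ -1`. [cite: ChelkakHonglerIzyurovAnnals2015, §3.2 (the cut L_a)] -/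
def slitU (k s : ℤ) : ℂ := if 0 ≤ s then slitFup k s else slitFdn k s

/-- Unfolding on the upper half. [folklore] -/
theorem slitU_of_nonneg (k : ℤ) {s : ℤ} (hs : 0 ≤ s) : slitU k s = slitFup k s := by rw [slitU, if_pos hs]

/-- Unfolding on the lower half. [folklore] -/
theorem slitU_of_neg (k : ℤ) {s : ℤ} (hs : s ≤ -1) : slitU k s = slitFdn k s := by rw [slitU, if_neg (by omega)]

/-- On the nonnegative row east of the source both sheets agree: `U(k, 0) = slitFdn k 0` for `k ≥ 0`. [folklore] -/
theorem slitU_row_eq_slitFdn {k : ℤ} (hk : 0 ≤ k) : slitU k 0 = slitFdn k 0 := by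
  rw [slitU_of_nonneg k le_rfl]
  refine slitFup_eq_slitFdn (Or.inr ?_)
  rcases Int.even_or_odd k with h | h
  · exact Or.inl h
  · exact Or.inr (by obtain ⟨m, rfl⟩ := h; omega)

/-- **The tip value** `U(0, 0) = 1`. [cite: ChelkakHonglerIzyurovAnnals2015, Lemma 2.14 (F(a+3δ/2) = 1)] -/
theorem slitU_zero_zero : slitU 0 0 = 1 := by rw [slitU_of_nonneg 0 le_rfl, slitFup_zero_zero]

/-- **The source value** `U(-1, 0) = -i` (CHI Lemma 3.5: `P_{iℝ} F_C(a + (1±i)δ/2) = ∓i` on `Ξ_+`). [cite: ChelkakHonglerIzyurovAnnals2015, Lemma 3.5] -/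
theorem slitU_neg_one_zero : slitU (-1) 0 = -I := by rw [slitU_of_nonneg (-1) le_rfl, slitFup_neg_one_zero]

/-- **`U` vanishes on the cut**: `U(k, 0) = 0` for even `k ≤ -2` (and at the odd `k ≥ 1` of the
row, the `i`-type corners of `R_a`). [cite: ChelkakHonglerIzyurovAnnals2015, §3.2 (F_C = 0 on L_a)] -/
theorem slitU_row_eq_zero {k : ℤ} (hk : (Even k ∧ k ≤ -2) ∨ (Odd k ∧ 1 ≤ k)) : slitU k 0 = 0 := by
  rw [slitU_of_nonneg k le_rfl, slitFup_row_eq_zero hk]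

/-- **The sheet change across the cut**: at the odd points of the negative row the two sheets are
opposite, `U(k,0) = slitFup k 0 = -slitFdn k 0`. [cite: ChelkakHonglerIzyurovAnnals2015, §3.2] -/
theorem slitU_row_eq_neg_slitFdn {k : ℤ} (hk : k ≤ -1) : slitU k 0 = -slitFdn k 0 := by
  rw [slitU_of_nonneg k le_rfl]
  rcases Int.even_or_odd k with h | h
  · -- even `k ≤ -2`: both vanish
    have hk2 : k ≤ -2 := by obtain ⟨m, rfl⟩ := h; omega
    rw [slitFup_row_eq_zero (Or.inl ⟨h, hk2⟩), ← slitFup_eq_slitFdn (Or.inr (Or.inl h)), slitFup_row_eq_zero (Or.inl ⟨h, hk2⟩),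
      neg_zero]
  · exact slitFup_row_eq_neg h

/-- **The Cauchy–Riemann identity of the section off the cut cells**: on every unit cell
`{k, k+1} × {s, s+1}` except those with `s = -1`, `k ≤ -1`,
`i (U(k+1,s+1) - U(k,s)) = U(k,s+1) - U(k+1,s)`. [cite: ChelkakHonglerIzyurovAnnals2015, Lemma 2.14 and Remark 3.1] -/
theorem slitU_cr {k s : ℤ} (h : s ≠ -1 ∨ 0 ≤ k) :
    I * (slitU (k + 1) (s + 1) - slitU k s) = slitU k (s + 1) - slitU (k + 1) s := by
  rcases le_or_gt 0 s with hs | hs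
  · rw [slitU_of_nonneg _ (by omega), slitU_of_nonneg _ hs, slitU_of_nonneg _ (by omega), slitU_of_nonneg _ hs]
    exact slitFup_cr k hs
  · rcases lt_or_eq_of_le (show s ≤ -1 by omega) with hs2 | hs1
    · rw [slitU_of_neg _ (by omega), slitU_of_neg _ (by omega), slitU_of_neg _ (by omega), slitU_of_neg _ (by omega)]
      exact slitFdn_cr k (by omega)
    · subst hs1
      have hk : 0 ≤ k := by
        rcases h with h | h
        · exact absurd rfl h
        · exact h
      simp only [show (-1 : ℤ) + 1 = 0 by norm_num]
      rw [slitU_row_eq_slitFdn (by omega), slitU_row_eq_slitFdn hk, slitU_of_neg _ le_rfl, slitU_of_neg _ le_rfl]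
      have := slitFdn_cr k (le_refl (-1 : ℤ))
      simpa using this

/-- **The cut cells**: for `s = -1` and `k ≤ -2` the identity holds after flipping the sign of the
lower row, `i (U(k+1,0) + U(k,-1)) = U(k,0) + U(k+1,-1)` — the sheet change across `L_a`. [cite: ChelkakHonglerIzyurovAnnals2015, §3.2] -/
theorem slitU_cr_cut {k : ℤ} (hk : k ≤ -2) :
    I * (slitU (k + 1) 0 + slitU k (-1)) = slitU k 0 + slitU (k + 1) (-1) := by
  rw [slitU_row_eq_neg_slitFdn (by omega), slitU_row_eq_neg_slitFdn (by omega), slitU_of_neg _ le_rfl, slitU_of_neg _ le_rfl]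
  have h := slitFdn_cr k (le_refl (-1 : ℤ))
  simp only [show (-1 : ℤ) + 1 = 0 by norm_num] at h
  linear_combination -h

end Literature.Probability.LatticeModels
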